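import Summits.CriticalPhenomena.PercolationContinuityZ3.Theorems.PercNearOneGluingNoHeavyLowerTailSahiPrincipalAntichain
import Summits.CriticalPhenomena.PercolationContinuityZ3.Theorems.PercNearOneGluingNoHeavyLowerTailFrontierIncRowsLeFive
import HarnessLib

/-!
# Principal cluster events on graphs with at most five vertices: three targets at every order; `K₄` at every order

Support file for the Sahi programme (`--supports stmt-CriticalPhenomena-4575`, prover prim-sahi-p2 gen 10).  COMPUTATIONAL:
it combines the (standard-axiom) antichain reduction and three-target theorem of `…SahiPrincipalAntichain` with the
kernel-computational increasing star on `≤ 5` vertices, `FrontierIncRows.incStar_le_five` (`native_decide` comb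
certificates of prim-bnk-1), and therefore depends on those `native_decide` axioms.  No definitions, no named facts, no sorries.
Memo `…/prim-sahi-p2/PROOF-E3.md` §21.

* `sahiE_principal_threeTargets_le_five`: on every weighted graph with `≤ 5` vertices, every family of principal cluster events
  `{C_s ⊇ T_i}` with targets among any three vertices is Sahi-positive at EVERY order.
* `sahiE_principal_fin_four`: on every weighted graph with FOUR vertices (e.g. `K₄` — the first graph that is not
  series–parallel — and `K₄ − e`, the first θ-graph, with arbitrary edge weights) EVERY family of principal cluster events
  (arbitrary target sets, the root allowed as a target, repeats allowed) is Sahi-positive at EVERY order: the first all-orders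
  statement of the programme beyond cactus graphs (`…SahiPrincipalCutVertex`, `…SahiPrincipalCycleBlocks`).
-/

noncomputable section

namespace Summit.CriticalPhenomena.PercolationContinuityZ3.Theorems

namespace SahiPrincipalAntichain

open Finset MeasureTheory Literature.Combinatorics.Sahi2008 Literature.Probability.Percolation
  Literature.Probability.LatticeModels
open Literature.Probability.Percolation.DecisionTree (ind ind_of_mem ind_of_not_mem ind_nonneg)
open scoped Classical

/-! ### Consequences on small graphs (with `FrontierIncRows.incStar_le_five`) -/

section SmallGraphs

variable {n : ℕ}

/-- `{s ↔ s}` is the sure event (plumbing). [folklore] -/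
private theorem openConn_self' {V : Type*} (s : V) : (openConn s s : Set (BondConfig V)) = Set.univ := by
  ext ω
  simp only [openConn, Set.mem_setOf_eq, Set.mem_univ, iff_true]
  exact SimpleGraph.Reachable.refl _

/-- **Every weighted graph with at most five vertices: every principal family with targets among any three vertices
`a, b, c` (distinct from each other and from the root) is Sahi-positive at EVERY order.**  From Theorem 2 and the increasing
star on `≤ 5` vertices (`FrontierIncRows.incStar_le_five`, kernel-checked comb certificates). [this work] -/
theorem sahiE_principal_threeTargets_le_five (hn : n ≤ 5) (w : Sym2 (Fin n) → unitInterval) (s a b c : Fin n)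
    (hsa : s ≠ a) (hsb : s ≠ b) (hsc : s ≠ c) (hab : a ≠ b) (hac : a ≠ c) (hbc : b ≠ c)
    (m : ℕ) (S : Fin m → Finset (Fin 3)) :
    0 ≤ sahiE (bernoulliWeight w) m
      (fun i => ind (⋂ j ∈ S i, (openConn s (![a, b, c] j) : Set (BondConfig (Fin n))))) :=
  sahiE_principal_threeTargets_of_incStar w s ![a, b, c]
    (FrontierIncRows.incStar_le_five hn w s a b c hsa hsb hsc hab hac hbc) m S

/-- **Every weighted graph on FOUR vertices (`K₄` and all its subgraphs, arbitrary edge weights): EVERY family of principal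
cluster events `{C_s ⊇ T_i}` (arbitrary finite target sets, the root allowed as a target, repeats allowed) is Sahi-positive
at EVERY order.**  The first all-orders statement beyond cactus graphs. [this work] -/
theorem sahiE_principal_fin_four (w : Sym2 (Fin 4) → unitInterval) (s : Fin 4) (m : ℕ) (T : Fin m → Finset (Fin 4)) :
    0 ≤ sahiE (bernoulliWeight w) m (fun i => ind (⋂ t ∈ T i, (openConn s t : Set (BondConfig (Fin 4))))) := by
  -- the three other vertices
  obtain ⟨v, hv, hsv⟩ : ∃ v : Fin 3 → Fin 4, (∀ t : Fin 4, t ≠ s → ∃ j, v j = t) ∧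
      (s ≠ v 0 ∧ s ≠ v 1 ∧ s ≠ v 2 ∧ v 0 ≠ v 1 ∧ v 0 ≠ v 2 ∧ v 1 ≠ v 2) := by
    fin_cases s
    · exact ⟨![1, 2, 3], by decide, by decide⟩
    · exact ⟨![0, 2, 3], by decide, by decide⟩
    · exact ⟨![0, 1, 3], by decide, by decide⟩
    · exact ⟨![0, 1, 2], by decide, by decide⟩
  obtain ⟨hs0, hs1, hs2, h01, h02, h12⟩ := hsv
  -- rewrite each principal event through the three other vertices
  let S : Fin m → Finset (Fin 3) := fun i => Finset.univ.filter fun j => v j ∈ T i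
  have hev : ∀ i, (⋂ t ∈ T i, (openConn s t : Set (BondConfig (Fin 4)))) =
      ⋂ j ∈ S i, (openConn s (v j) : Set (BondConfig (Fin 4))) := by
    intro i
    ext ω
    simp only [Set.mem_iInter, S, Finset.mem_filter, Finset.mem_univ, true_and]
    constructor
    · intro h j hj
      exact h (v j) hj
    · intro h t ht
      by_cases hts : t = s
      · subst hts
        rw [openConn_self']
        exact Set.mem_univ _
      · obtain ⟨j, rfl⟩ := hv t hts
        exact h j ht
  have hfam : (fun i => ind (⋂ t ∈ T i, (openConn s t : Set (BondConfig (Fin 4))))) =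
      fun i => ind (⋂ j ∈ S i, (openConn s (v j) : Set (BondConfig (Fin 4)))) := by
    funext i; rw [hev i]
  rw [hfam]
  have hv' : v = ![v 0, v 1, v 2] := by funext j; fin_cases j <;> rfl
  have hstar := FrontierIncRows.incStar_le_five (by norm_num) w s (v 0) (v 1) (v 2) hs0 hs1 hs2 h01 h02 h12
  exact sahiE_principal_threeTargets_of_incStar w s v hstar m S

end SmallGraphs

end SahiPrincipalAntichain

end Summit.CriticalPhenomena.PercolationContinuityZ3.Theorems
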